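import Mathlib

/-!
# THE PLANAR LENGTH–AREA LEMMA (ROUND-42 «THE CONDENSER», step (B3) without symmetrisation)

Width piece for crux `EulerZoomLiouville.PowerGaugeEulerLiouville` (stmt-NavierStokesRegularity-19832), by name under
LEAD 19832 (ns-typeII-p2 g12); seat ns-ezl-w2 g3, `--supports stmt-NavierStokesRegularity-19832 --as helper`.
nsreg-p2 g33's ROUND-42 THEOREM B («leaving `B(0,2R)` costs a gradient `exp(c·R^{2+ρ})`») estimates, on a quiet slice
through the exiting orbit, the Dirichlet energy of `|V|` between a small disc where `|V| ≥ 3m/4` and the large set where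
`|V| ≤ m/2` by the capacity of a condenser after spherical symmetrisation [Baernstein–Taylor].  THIS FILE replaces that
step by an ELEMENTARY length–area argument on rays (Mathlib only), in the polar chart `polarCoord` of `ℝ × ℝ`:

* `two_mul_le_weight`, `sq_integral_le_log_mul_integral` — the weighted Cauchy–Schwarz inequality on `[a, b] ⊂ (0, ∞)`:
  `(∫_a^b h)² ≤ log(b/a) · ∫_a^b h² r dr` (from `∫ (√λ h √r − 1/√(λ r))² ≥ 0`, optimised in `λ`).
* `hasDerivAt_polarCoord_symm_ray`, `norm_sub_le_integral_norm_fderiv_ray` — along the ray `r ↦ (r cos θ, r sin θ)` a `C¹`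
  map `g` moves by at most `∫ ‖Dg‖ dr` (the direction `(cos θ, sin θ)` has sup-norm `≤ 1`).
* `sq_le_log_mul_integral_ray` — ONE SHORT RAY: if `‖g‖ ≥ 3m/4` at radius `w₀` and `‖g‖ ≤ m/2` somewhere on `[w₀, r★]` along
  the ray, then `m²/16 ≤ log(r★/w₀) · ∫_{w₀}^{r★} ‖Dg(r u_θ)‖² r dr`.
* **`pi_mul_sq_le_log_mul_integral` — THE LENGTH–AREA LEMMA**: if a measurable set `Θ ⊆ (−π, π)` of directions of measure
  `≥ π` consists of short rays, then `π·m²/16 ≤ log(r★/w₀) · ∫_A ‖Dg‖²` for every measurable `A ⊇ polarCoord.symm '' ([w₀, r★] ×ˢ Θ)`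
  on which `‖Dg‖²` is integrable (Fubini in `(r, θ)` + the change of variables `integral_image_eq_integral_abs_det_fderiv_smul`
  with Jacobian `r`).  This is the condenser bound `cap ≥ 2π/log(r★/w₀)` up to the factor of the short directions, with NO
  capacity theory: in THEOREM B the long directions (rays staying in `{|V| > m/2}`) fill an area `≤ area{|V| > m/2}`, which
  Chebyshev and the A-gauge make small, so at least half of the directions are short.
  `pi_mul_sq_div_log_le_integral_image` is nsreg-p2 g33's form `π·m²/(16·log(r★/w₀)) ≤ ∫_{polarCoord.symm '' ([w₀,r★] ×ˢ Θ)} ‖Dg‖²`.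

HONEST FRAMING: a lemma of real analysis in the plane; nothing here proves the crux E `PowerGaugeEulerLiouville` (19832 OPEN),
any door Target, or any Navier–Stokes statement; MODEL lattice only (19832 is a crux CLASS — E/NS strata — not NS regularity).
[folklore (length–area method / extremal length, Ahlfors–Beurling); cite: ConstantinIgnatovaVicol2026Putative, §3.4.1 for the setting]
-/

noncomputable section

open Set Filter Topology Metric Function MeasureTheory Real

set_option linter.dupNamespace false

namespace Summit.NavierStokesRegularity.NavierStokesRegularity.Theorems.PowerGaugeEulerLiouville.Condenser

/-! ## Weighted Cauchy–Schwarz on a ray -/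

/-- Pointwise AM–GM behind the weighted Cauchy–Schwarz inequality: `2h ≤ λ h² r + 1/(λ r)` for `λ, r > 0`. [folklore] -/
theorem two_mul_le_weight {lam r : ℝ} (hlam : 0 < lam) (hr : 0 < r) (h : ℝ) :
    2 * h ≤ lam * (h ^ 2 * r) + 1 / (lam * r) := by
  have hlr : 0 < lam * r := mul_pos hlam hr
  have key : lam * (h ^ 2 * r) + 1 / (lam * r) - 2 * h = (lam * r * h - 1) ^ 2 / (lam * r) := by
    field_simp
    ring
  have : 0 ≤ (lam * r * h - 1) ^ 2 / (lam * r) := div_nonneg (sq_nonneg _) hlr.le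
  linarith

/-- One-parameter family behind the weighted Cauchy–Schwarz inequality: for `h` continuous on `[a, b] ⊂ (0, ∞)` and
`λ > 0`, `2∫_a^b h ≤ λ ∫_a^b h² r dr + log(b/a)/λ`. [folklore] -/
theorem two_mul_integral_le_weight {a b : ℝ} (ha : 0 < a) (hab : a ≤ b) {h : ℝ → ℝ}
    (hc : ContinuousOn h (Icc a b)) {lam : ℝ} (hlam : 0 < lam) :
    2 * ∫ r in a..b, h r ≤ lam * (∫ r in a..b, h r ^ 2 * r) + Real.log (b / a) / lam := by
  have hpos : ∀ r ∈ Icc a b, 0 < r := fun r hr => ha.trans_le hr.1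
  have hcI : ContinuousOn h (uIcc a b) := by rwa [uIcc_of_le hab]
  have hc2 : ContinuousOn (fun r => h r ^ 2 * r) (uIcc a b) := (hcI.pow 2).mul continuousOn_id
  have hcinv : ContinuousOn (fun r : ℝ => r⁻¹) (uIcc a b) := by
    rw [uIcc_of_le hab]
    exact continuousOn_inv₀.mono fun r hr => (hpos r hr).ne'
  have hYint : ∫ r in a..b, r⁻¹ = Real.log (b / a) := by
    rw [integral_inv (fun h0 => ?_)]
    rw [uIcc_of_le hab] at h0
    exact (lt_irrefl (0 : ℝ)) (hpos 0 h0)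
  have hmono : ∫ r in a..b, 2 * h r ≤ ∫ r in a..b, (lam * (h r ^ 2 * r) + lam⁻¹ * r⁻¹) := by
    refine intervalIntegral.integral_mono_on hab (hcI.intervalIntegrable.const_mul 2)
      ((hc2.intervalIntegrable.const_mul lam).add (hcinv.intervalIntegrable.const_mul lam⁻¹)) ?_
    intro r hr
    have h1 := two_mul_le_weight hlam (hpos r hr) (h r)
    rw [one_div, mul_inv] at h1
    exact h1
  rw [intervalIntegral.integral_const_mul, intervalIntegral.integral_add (hc2.intervalIntegrable.const_mul lam)
    (hcinv.intervalIntegrable.const_mul lam⁻¹), intervalIntegral.integral_const_mul,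
    intervalIntegral.integral_const_mul, hYint] at hmono
  rw [div_eq_inv_mul]
  linarith

/-- Optimising `2I ≤ λX + Y/λ` (`λ > 0`) for `I, X, Y ≥ 0` gives `I² ≤ Y·X`. [folklore] -/
theorem sq_le_mul_of_forall_weight {I X Y : ℝ} (hI : 0 ≤ I) (hX : 0 ≤ X) (hY : 0 ≤ Y)
    (h : ∀ lam : ℝ, 0 < lam → 2 * I ≤ lam * X + Y / lam) : I ^ 2 ≤ Y * X := by
  rcases hI.eq_or_lt with hI0 | hI0
  · rw [← hI0]; simpa using mul_nonneg hY hX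
  by_cases hX' : X = 0
  · exfalso
    have h1 := h ((Y + 1) / I) (div_pos (by linarith) hI0)
    rw [hX', mul_zero, zero_add, div_div_eq_mul_div, le_div_iff₀ (by linarith)] at h1
    nlinarith [mul_nonneg hI hY]
  · have hXpos : 0 < X := lt_of_le_of_ne hX (Ne.symm hX')
    have h1 := h (I / X) (div_pos hI0 hXpos)
    rw [div_mul_cancel₀ _ hX', div_div_eq_mul_div] at h1
    have h2 : I ≤ Y * X / I := by linarith
    rw [le_div_iff₀ hI0] at h2
    nlinarith

/-- **Weighted Cauchy–Schwarz on `[a, b] ⊂ (0, ∞)`**: for `h` continuous on `[a, b]`,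
`(∫_a^b h)² ≤ log(b/a) · ∫_a^b h(r)² r dr`. [folklore] -/
theorem sq_integral_le_log_mul_integral {a b : ℝ} (ha : 0 < a) (hab : a ≤ b) {h : ℝ → ℝ}
    (hc : ContinuousOn h (Icc a b)) :
    (∫ r in a..b, h r) ^ 2 ≤ Real.log (b / a) * ∫ r in a..b, h r ^ 2 * r := by
  have hpos : ∀ r ∈ Icc a b, 0 < r := fun r hr => ha.trans_le hr.1
  have hX0 : 0 ≤ ∫ r in a..b, h r ^ 2 * r :=
    intervalIntegral.integral_nonneg hab fun r hr => mul_nonneg (sq_nonneg _) (hpos r hr).le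
  have hY0 : 0 ≤ Real.log (b / a) := Real.log_nonneg ((one_le_div ha).2 hab)
  by_cases hI : 0 ≤ ∫ r in a..b, h r
  · exact sq_le_mul_of_forall_weight hI hX0 hY0 fun lam hlam => two_mul_integral_le_weight ha hab hc hlam
  · push Not at hI
    have hneg : ∀ lam : ℝ, 0 < lam →
        2 * (-∫ r in a..b, h r) ≤ lam * (∫ r in a..b, h r ^ 2 * r) + Real.log (b / a) / lam := by
      intro lam hlam
      have h1 := two_mul_integral_le_weight ha hab (h := fun r => -h r) hc.neg hlam
      have e1 : ∫ r in a..b, (fun r => -h r) r = -∫ r in a..b, h r := by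
        simp only [intervalIntegral.integral_neg]
      have e2 : ∫ r in a..b, (fun r => -h r) r ^ 2 * r = ∫ r in a..b, h r ^ 2 * r := by
        simp only [neg_sq]
      rw [e1, e2] at h1
      exact h1
    have h2 := sq_le_mul_of_forall_weight (by linarith) hX0 hY0 hneg
    rwa [neg_sq] at h2

/-! ## Rays in the polar chart -/

/-- The ray `r ↦ polarCoord.symm (r, θ) = (r cos θ, r sin θ)` has velocity `(cos θ, sin θ)`. [folklore] -/
theorem hasDerivAt_polarCoord_symm_ray (θ r : ℝ) :
    HasDerivAt (fun s : ℝ => polarCoord.symm (s, θ)) (Real.cos θ, Real.sin θ) r := by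
  have h1 : HasDerivAt (fun s : ℝ => s * Real.cos θ) (Real.cos θ) r := by
    simpa using (hasDerivAt_id r).mul_const (Real.cos θ)
  have h2 : HasDerivAt (fun s : ℝ => s * Real.sin θ) (Real.sin θ) r := by
    simpa using (hasDerivAt_id r).mul_const (Real.sin θ)
  have h := h1.prodMk h2
  refine h.congr_of_eventuallyEq (Filter.Eventually.of_forall fun s => ?_)
  simp [polarCoord_symm_apply]

/-- The unit direction `(cos θ, sin θ)` has (sup-)norm at most one in `ℝ × ℝ`. [folklore] -/
theorem norm_cos_sin_le_one (θ : ℝ) : ‖(Real.cos θ, Real.sin θ)‖ ≤ 1 := by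
  rw [Prod.norm_def]
  exact max_le (by simpa using Real.abs_cos_le_one θ) (by simpa using Real.abs_sin_le_one θ)

/-- **Motion along a ray is bounded by the integral of the gradient**: for `g ∈ C¹(ℝ × ℝ, F)` and `a ≤ b`,
`‖g(b u_θ) − g(a u_θ)‖ ≤ ∫_a^b ‖Dg(r u_θ)‖ dr`, `u_θ = (cos θ, sin θ)`. [folklore] -/
theorem norm_sub_le_integral_norm_fderiv_ray {F : Type*} [NormedAddCommGroup F] [NormedSpace ℝ F] [CompleteSpace F]
    {g : ℝ × ℝ → F} (hg : ContDiff ℝ 1 g) (θ : ℝ) {a b : ℝ} (hab : a ≤ b) :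
    ‖g (polarCoord.symm (b, θ)) - g (polarCoord.symm (a, θ))‖ ≤
      ∫ r in a..b, ‖fderiv ℝ g (polarCoord.symm (r, θ))‖ := by
  have hgd : Differentiable ℝ g := hg.differentiable one_ne_zero
  have hray : Continuous fun s : ℝ => polarCoord.symm (s, θ) :=
    continuous_iff_continuousAt.2 fun s => (hasDerivAt_polarCoord_symm_ray θ s).continuousAt
  -- derivative of `g` along the ray
  have hderiv : ∀ s, HasDerivAt (fun s : ℝ => g (polarCoord.symm (s, θ)))
      (fderiv ℝ g (polarCoord.symm (s, θ)) (Real.cos θ, Real.sin θ)) s :=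
    fun s => (hgd _).hasFDerivAt.comp_hasDerivAt s (hasDerivAt_polarCoord_symm_ray θ s)
  have hcontD : Continuous fun s : ℝ => fderiv ℝ g (polarCoord.symm (s, θ)) (Real.cos θ, Real.sin θ) :=
    ((hg.continuous_fderiv one_ne_zero).comp hray).clm_apply continuous_const
  have hftc := intervalIntegral.integral_eq_sub_of_hasDerivAt (fun s _ => hderiv s)
    (hcontD.intervalIntegrable a b)
  rw [← hftc]
  refine (intervalIntegral.norm_integral_le_integral_norm hab).trans ?_
  refine intervalIntegral.integral_mono_on hab (hcontD.norm.intervalIntegrable a b)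
    (((hg.continuous_fderiv one_ne_zero).comp hray).norm.intervalIntegrable a b) fun s _ => ?_
  exact (ContinuousLinearMap.le_opNorm _ _).trans
    (mul_le_of_le_one_right (norm_nonneg _) (norm_cos_sin_le_one θ))

/-- **ONE SHORT RAY**: `g ∈ C¹`, `0 < w₀`, `‖g(w₀ u_θ)‖ ≥ 3m/4`, `0 ≤ m`, and `‖g(r₁ u_θ)‖ ≤ m/2` for some `r₁ ∈ [w₀, r★]`;
then `m²/16 ≤ log(r★/w₀) · ∫_{w₀}^{r★} ‖Dg(r u_θ)‖² r dr`. [folklore (length–area)] -/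
theorem sq_le_log_mul_integral_ray {F : Type*} [NormedAddCommGroup F] [NormedSpace ℝ F] [CompleteSpace F]
    {g : ℝ × ℝ → F} (hg : ContDiff ℝ 1 g) {m w₀ rs : ℝ} (hm : 0 ≤ m) (hw₀ : 0 < w₀) (θ : ℝ)
    (h₀ : 3 * m / 4 ≤ ‖g (polarCoord.symm (w₀, θ))‖)
    {r₁ : ℝ} (hr₁ : r₁ ∈ Icc w₀ rs) (h₁ : ‖g (polarCoord.symm (r₁, θ))‖ ≤ m / 2) :
    m ^ 2 / 16 ≤ Real.log (rs / w₀) * ∫ r in w₀..rs, ‖fderiv ℝ g (polarCoord.symm (r, θ))‖ ^ 2 * r := by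
  have hray : Continuous fun s : ℝ => polarCoord.symm (s, θ) :=
    continuous_iff_continuousAt.2 fun s => (hasDerivAt_polarCoord_symm_ray θ s).continuousAt
  have hcn : Continuous fun s : ℝ => ‖fderiv ℝ g (polarCoord.symm (s, θ))‖ :=
    ((hg.continuous_fderiv one_ne_zero).comp hray).norm
  set I : ℝ := ∫ r in w₀..r₁, ‖fderiv ℝ g (polarCoord.symm (r, θ))‖ with hI
  -- `m/4 ≤ I`
  have hI1 : m / 4 ≤ I := by
    have h := norm_sub_le_integral_norm_fderiv_ray hg θ hr₁.1
    have h' : ‖g (polarCoord.symm (w₀, θ))‖ - ‖g (polarCoord.symm (r₁, θ))‖ ≤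
        ‖g (polarCoord.symm (r₁, θ)) - g (polarCoord.symm (w₀, θ))‖ := by
      rw [← norm_neg (g (polarCoord.symm (r₁, θ)) - g (polarCoord.symm (w₀, θ))), neg_sub]
      exact norm_sub_norm_le _ _
    linarith
  -- Cauchy–Schwarz on `[w₀, r₁]`, then enlarge to `[w₀, r★]`
  have hCS := sq_integral_le_log_mul_integral hw₀ hr₁.1 hcn.continuousOn
  have hr₁pos : 0 < r₁ := hw₀.trans_le hr₁.1
  have hlog : Real.log (r₁ / w₀) ≤ Real.log (rs / w₀) :=
    Real.log_le_log (div_pos hr₁pos hw₀) (div_le_div_of_nonneg_right hr₁.2 hw₀.le)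
  have hlog0 : 0 ≤ Real.log (r₁ / w₀) := Real.log_nonneg ((one_le_div hw₀).2 hr₁.1)
  have hint : ∫ r in w₀..r₁, ‖fderiv ℝ g (polarCoord.symm (r, θ))‖ ^ 2 * r ≤
      ∫ r in w₀..rs, ‖fderiv ℝ g (polarCoord.symm (r, θ))‖ ^ 2 * r := by
    refine intervalIntegral.integral_mono_interval le_rfl hr₁.1 hr₁.2 ?_
      (((hcn.pow 2).mul continuous_id).intervalIntegrable w₀ rs)
    exact (ae_restrict_iff' measurableSet_Ioc).2
      (Filter.Eventually.of_forall fun r hr => mul_nonneg (sq_nonneg _) (hw₀.le.trans hr.1.le))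
  have hint0 : 0 ≤ ∫ r in w₀..rs, ‖fderiv ℝ g (polarCoord.symm (r, θ))‖ ^ 2 * r :=
    intervalIntegral.integral_nonneg (hr₁.1.trans hr₁.2) fun r hr =>
      mul_nonneg (sq_nonneg _) (hw₀.le.trans hr.1)
  have hsq : (m / 4) ^ 2 ≤ I ^ 2 := pow_le_pow_left₀ (by linarith) hI1 2
  calc m ^ 2 / 16 = (m / 4) ^ 2 := by ring
    _ ≤ I ^ 2 := hsq
    _ ≤ Real.log (r₁ / w₀) * ∫ r in w₀..r₁, ‖fderiv ℝ g (polarCoord.symm (r, θ))‖ ^ 2 * r := hCS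
    _ ≤ Real.log (rs / w₀) * ∫ r in w₀..rs, ‖fderiv ℝ g (polarCoord.symm (r, θ))‖ ^ 2 * r := by
        have h1 : 0 ≤ ∫ r in w₀..r₁, ‖fderiv ℝ g (polarCoord.symm (r, θ))‖ ^ 2 * r :=
          intervalIntegral.integral_nonneg hr₁.1 fun r hr => mul_nonneg (sq_nonneg _) (hw₀.le.trans hr.1)
        calc Real.log (r₁ / w₀) * ∫ r in w₀..r₁, ‖fderiv ℝ g (polarCoord.symm (r, θ))‖ ^ 2 * r
            ≤ Real.log (r₁ / w₀) * ∫ r in w₀..rs, ‖fderiv ℝ g (polarCoord.symm (r, θ))‖ ^ 2 * r :=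
              mul_le_mul_of_nonneg_left hint hlog0
          _ ≤ Real.log (rs / w₀) * ∫ r in w₀..rs, ‖fderiv ℝ g (polarCoord.symm (r, θ))‖ ^ 2 * r :=
              mul_le_mul_of_nonneg_right hlog hint0


/-! ## The length–area lemma -/

/-- **THE PLANAR LENGTH–AREA LEMMA (condenser bound without symmetrisation).**  `g ∈ C¹(ℝ × ℝ, F)`, `0 ≤ m`,
`0 < w₀ ≤ r★`; `Θ ⊆ (−π, π)` a measurable set of directions of measure `≥ π` such that along every ray `θ ∈ Θ`:
`‖g(w₀ u_θ)‖ ≥ 3m/4` and `‖g(r u_θ)‖ ≤ m/2` for some `r ∈ [w₀, r★]` (a SHORT ray).  Then for every measurable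
`A ⊇ polarCoord.symm '' ([w₀, r★] ×ˢ Θ)` on which `‖Dg‖²` is integrable:
`π · m²/16 ≤ log(r★/w₀) · ∫_A ‖Dg‖²`.
(Per ray: `m²/16 ≤ log(r★/w₀)∫_{w₀}^{r★}‖Dg(ru_θ)‖² r dr`; integrate over `Θ` (Fubini) and change variables with Jacobian `r`.)
[folklore (length–area method); cite: ConstantinIgnatovaVicol2026Putative, §3.4.1 for the setting] -/
theorem pi_mul_sq_le_log_mul_integral {F : Type*} [NormedAddCommGroup F] [NormedSpace ℝ F] [CompleteSpace F]
    {g : ℝ × ℝ → F} (hg : ContDiff ℝ 1 g) {m w₀ rs : ℝ} (hm : 0 ≤ m) (hw₀ : 0 < w₀) (hwr : w₀ ≤ rs)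
    {Θ : Set ℝ} (hΘm : MeasurableSet Θ) (hΘsub : Θ ⊆ Ioo (-Real.pi) Real.pi)
    (hΘvol : ENNReal.ofReal Real.pi ≤ volume Θ)
    (h₀ : ∀ θ ∈ Θ, 3 * m / 4 ≤ ‖g (polarCoord.symm (w₀, θ))‖)
    (hhit : ∀ θ ∈ Θ, ∃ r ∈ Icc w₀ rs, ‖g (polarCoord.symm (r, θ))‖ ≤ m / 2)
    {A : Set (ℝ × ℝ)} (hA : polarCoord.symm '' (Icc w₀ rs ×ˢ Θ) ⊆ A)
    (hint : IntegrableOn (fun x => ‖fderiv ℝ g x‖ ^ 2) A) :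
    Real.pi * m ^ 2 / 16 ≤ Real.log (rs / w₀) * ∫ x in A, ‖fderiv ℝ g x‖ ^ 2 := by
  -- notation: `G` the energy density, `Fn` its pull-back to the chart times the Jacobian `r`
  set G : ℝ × ℝ → ℝ := fun x => ‖fderiv ℝ g x‖ ^ 2 with hG
  set Fn : ℝ × ℝ → ℝ := fun p => G (polarCoord.symm p) * p.1 with hFn
  set S : Set (ℝ × ℝ) := Icc w₀ rs ×ˢ Θ with hS
  have hSm : MeasurableSet S := measurableSet_Icc.prod hΘm
  have hSsub : S ⊆ polarCoord.target := by
    rintro ⟨r, θ⟩ ⟨hr, hθ⟩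
    rw [polarCoord_target]
    exact ⟨hw₀.trans_le hr.1, hΘsub hθ⟩
  have hlog0 : 0 ≤ Real.log (rs / w₀) := Real.log_nonneg ((one_le_div hw₀).2 hwr)
  -- continuity and integrability of the chart integrand
  have hGc : Continuous G := ((hg.continuous_fderiv one_ne_zero).norm).pow 2
  have hpc : Continuous fun p : ℝ × ℝ => polarCoord.symm p := by
    simp only [polarCoord_symm_apply]
    fun_prop
  have hFc : Continuous Fn := (hGc.comp hpc).mul continuous_fst
  have hScpt : S ⊆ Icc w₀ rs ×ˢ Icc (-Real.pi) Real.pi := prod_mono le_rfl (hΘsub.trans Ioo_subset_Icc_self)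
  have hFint : IntegrableOn Fn S :=
    (hFc.continuousOn.integrableOn_compact (isCompact_Icc.prod isCompact_Icc)).mono_set hScpt
  have hFint' : Integrable Fn ((volume.restrict (Icc w₀ rs)).prod (volume.restrict Θ)) := by
    rw [Measure.prod_restrict, ← Measure.volume_eq_prod]; exact hFint
  -- (1) per short direction
  have hray : ∀ θ ∈ Θ, m ^ 2 / 16 ≤ Real.log (rs / w₀) * ∫ r in Icc w₀ rs, Fn (r, θ) := by
    intro θ hθ
    obtain ⟨r₁, hr₁, h₁⟩ := hhit θ hθ
    have h := sq_le_log_mul_integral_ray hg hm hw₀ θ (h₀ θ hθ) hr₁ h₁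
    have e : ∫ r in w₀..rs, ‖fderiv ℝ g (polarCoord.symm (r, θ))‖ ^ 2 * r = ∫ r in Icc w₀ rs, Fn (r, θ) := by
      rw [intervalIntegral.integral_of_le hwr, integral_Icc_eq_integral_Ioc]
    rwa [e] at h
  -- (2) integrate over `Θ` (Fubini)
  have hΘfin : volume Θ ≠ ⊤ := ((measure_mono hΘsub).trans_lt measure_Ioo_lt_top).ne
  have hΘreal : Real.pi ≤ (volume Θ).toReal := by
    have h := ENNReal.toReal_mono hΘfin hΘvol
    rwa [ENNReal.toReal_ofReal Real.pi_pos.le] at h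
  have hfub : ∫ p in S, Fn p = ∫ θ in Θ, ∫ r in Icc w₀ rs, Fn (r, θ) := by
    calc ∫ p in S, Fn p = ∫ p, Fn p ∂((volume.restrict (Icc w₀ rs)).prod (volume.restrict Θ)) := by
          rw [Measure.prod_restrict, ← Measure.volume_eq_prod]
      _ = ∫ θ in Θ, ∫ r in Icc w₀ rs, Fn (r, θ) := integral_prod_symm Fn hFint'
  have hinner : Integrable (fun θ => ∫ r in Icc w₀ rs, Fn (r, θ)) (volume.restrict Θ) :=
    hFint'.integral_prod_right
  have h2 : (volume Θ).toReal * (m ^ 2 / 16) ≤ Real.log (rs / w₀) * ∫ p in S, Fn p := by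
    have h := setIntegral_mono_on (integrableOn_const hΘfin) (hinner.const_mul (Real.log (rs / w₀))) hΘm
      (fun θ hθ => hray θ hθ)
    rw [setIntegral_const, smul_eq_mul, measureReal_def, integral_const_mul] at h
    rwa [hfub]
  -- (3) change of variables `x = polarCoord.symm (r, θ)`, Jacobian `r`
  have hcov : ∫ x in polarCoord.symm '' S, G x = ∫ p in S, Fn p := by
    have hinj : InjOn (fun p : ℝ × ℝ => polarCoord.symm p) S := by
      have h := polarCoord.symm.injOn
      rw [OpenPartialHomeomorph.symm_source] at h
      exact h.mono hSsub
    rw [integral_image_eq_integral_abs_det_fderiv_smul volume hSm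
      (fun p _ => (hasFDerivAt_polarCoord_symm p).hasFDerivWithinAt) hinj G]
    refine setIntegral_congr_fun hSm fun p hp => ?_
    rw [det_fderivPolarCoordSymm, abs_of_pos (hw₀.trans_le hp.1.1), smul_eq_mul, hFn, mul_comm]
  -- (4) enlarge the domain
  have hmono : ∫ x in polarCoord.symm '' S, G x ≤ ∫ x in A, G x :=
    setIntegral_mono_set hint (Filter.Eventually.of_forall fun x => sq_nonneg _) (ae_of_all _ hA)
  -- (5) assemble
  calc Real.pi * m ^ 2 / 16 ≤ (volume Θ).toReal * (m ^ 2 / 16) := by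
        rw [mul_div_assoc]
        exact mul_le_mul_of_nonneg_right hΘreal (by positivity)
    _ ≤ Real.log (rs / w₀) * ∫ p in S, Fn p := h2
    _ = Real.log (rs / w₀) * ∫ x in polarCoord.symm '' S, G x := by rw [hcov]
    _ ≤ Real.log (rs / w₀) * ∫ x in A, G x := mul_le_mul_of_nonneg_left hmono hlog0


/-- **THE PLANAR LENGTH–AREA LEMMA, nsreg-p2's form** (integral over the swept sector itself, divided by the logarithm):
under the hypotheses of `pi_mul_sq_le_log_mul_integral`,
`π · m² / (16 · log(r★/w₀)) ≤ ∫_{polarCoord.symm '' ([w₀, r★] ×ˢ Θ)} ‖Dg‖²`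
(for `w₀ = r★` the left-hand side is `0` by `x / 0 = 0`). [folklore (length–area method)] -/
theorem pi_mul_sq_div_log_le_integral_image {F : Type*} [NormedAddCommGroup F] [NormedSpace ℝ F] [CompleteSpace F]
    {g : ℝ × ℝ → F} (hg : ContDiff ℝ 1 g) {m w₀ rs : ℝ} (hm : 0 ≤ m) (hw₀ : 0 < w₀) (hwr : w₀ ≤ rs)
    {Θ : Set ℝ} (hΘm : MeasurableSet Θ) (hΘsub : Θ ⊆ Ioo (-Real.pi) Real.pi)
    (hΘvol : ENNReal.ofReal Real.pi ≤ volume Θ)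
    (h₀ : ∀ θ ∈ Θ, 3 * m / 4 ≤ ‖g (polarCoord.symm (w₀, θ))‖)
    (hhit : ∀ θ ∈ Θ, ∃ r ∈ Icc w₀ rs, ‖g (polarCoord.symm (r, θ))‖ ≤ m / 2) :
    Real.pi * m ^ 2 / (16 * Real.log (rs / w₀)) ≤
      ∫ p in polarCoord.symm '' (Icc w₀ rs ×ˢ Θ), ‖fderiv ℝ g p‖ ^ 2 := by
  -- integrability on the swept sector: it lies in the compact image of `[w₀, r★] × [−π, π]`
  have hGc : Continuous fun x : ℝ × ℝ => ‖fderiv ℝ g x‖ ^ 2 := ((hg.continuous_fderiv one_ne_zero).norm).pow 2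
  have hpc : Continuous fun p : ℝ × ℝ => polarCoord.symm p := by
    simp only [polarCoord_symm_apply]
    fun_prop
  have hK : IsCompact ((fun p : ℝ × ℝ => polarCoord.symm p) '' (Icc w₀ rs ×ˢ Icc (-Real.pi) Real.pi)) :=
    (isCompact_Icc.prod isCompact_Icc).image hpc
  have hsub : polarCoord.symm '' (Icc w₀ rs ×ˢ Θ) ⊆
      (fun p : ℝ × ℝ => polarCoord.symm p) '' (Icc w₀ rs ×ˢ Icc (-Real.pi) Real.pi) :=
    image_mono (prod_mono le_rfl (hΘsub.trans Ioo_subset_Icc_self))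
  have hint : IntegrableOn (fun x : ℝ × ℝ => ‖fderiv ℝ g x‖ ^ 2) (polarCoord.symm '' (Icc w₀ rs ×ˢ Θ)) :=
    (hGc.continuousOn.integrableOn_compact hK).mono_set hsub
  have hmain := pi_mul_sq_le_log_mul_integral hg hm hw₀ hwr hΘm hΘsub hΘvol h₀ hhit subset_rfl hint
  have hI0 : 0 ≤ ∫ p in polarCoord.symm '' (Icc w₀ rs ×ˢ Θ), ‖fderiv ℝ g p‖ ^ 2 :=
    integral_nonneg fun x => sq_nonneg _
  rcases (Real.log_nonneg ((one_le_div hw₀).2 hwr)).eq_or_lt with hlog | hlog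
  · rw [← hlog, mul_zero, div_zero]
    exact hI0
  · rw [div_le_iff₀ (by positivity)]
    linarith

end Summit.NavierStokesRegularity.NavierStokesRegularity.Theorems.PowerGaugeEulerLiouville.Condenser

end
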